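import Literature.NumberTheory.EllipticCurves.Kobayashi2003.FineSelmerLeSignedSelmerProofs
import Literature.NumberTheory.EllipticCurves.Sprung2024.ChromaticSmallControlProofs
import Literature.NumberTheory.EllipticCurves.Sprung2012.SharpFlatSelmerModuleFiniteProofs
import Literature.NumberTheory.EllipticCurves.KatoFineSelmerDualMuProofs
import Literature.NumberTheory.EllipticCurves.IwasawaDualFunctorialityProofs
import Literature.NumberTheory.EllipticCurves.IwasawaAlgebraDivisibilityProofs
import HarnessLib

/-!
# `Sel₀(K_∞, E[p^∞]) ≤ Sel^•(E/K_∞)` for Sprung's chromatic Selmer groups (Def. 7.11 / 7.13), and its Pontryagin transpose: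
# a `Λ`-linear SURJECTION `X^•(E/K_∞) ↠ X₀(E/K_∞)` — the definitional end `X^∗ → X⁰ → 0` of Sprung's sequence (3)

`Proofs` file (theorems only: no definition, no named fact, no instance, no `sorry`) in the cluster `Sprung2012`; the ♯/♭
twin of `Kobayashi2003/FineSelmerLeSignedSelmerProofs.lean` (fine ≤ signed) and `Kobayashi2003/SignedSelmerDualToFineDualProofs.lean`
(`X^± ↠ X₀`). WHY (cell `bsd-ssimc`, width seat `cruxlead-stmt-BirchSwinnertonDyer-19875-w3` gen 9, crux `SprungLowerDivisibilityAtThree`,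
line `chromatic-common-zeros`): the Poitou–Tate functional model fact `thm714seq_sharpFlat_poitouTate_functionalModel` (p666901) and the
package field `SharpFlatColemanKatoData.exact` both carry the arrow `X^• → X⁰ → 0` of Sprung's (3) / Prop. 7.19 EXISTENTIALLY; this
file PROVES it on the tree's real objects — Sprung's `Sel⁰(E/K_∞) := Ker(Sel(E/K_∞) → E(K_{∞,𝔭}) ⊗ ℚ_p/ℤ_p)` (Def. 7.13; the tree's
`W.fineSelmerInfty κ`, everywhere-locally-trivial classes) lies in `Sel^∗(E/K_∞) := Ker(Sel(E/K_∞) → E(K_{∞,𝔭}) ⊗ ℚ_p/ℤ_p / E^∗_{∞,𝔭})`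
(Def. 7.11; the tree's `sharpFlatSelmerInfty`) because `0 ∈ E^∗_{∞,𝔭}` — and transposes the inclusion into a `Λ`-linear surjection of
Pontryagin duals, for EVERY number field, place, prime, colour, Honda data and key `γ`. The proof is the Kobayashi twin's §1 with the
divisibility clause of `sharpFlatLocalKummerOverOfEmb` added (a locally trivial class is the Kummer class of a TORSION point `Q`,
`pᵏQ = 0`, and `z(0) = 0` is divisible by `pᵏ` for every functional `z`), and WITHOUT the layer descent of the signed case (Sprung's
condition lives at the top of the tower).

* §1 `mem_sharpFlatLocalKummerOverOfEmb_of_principal` — principal on `H ⊓ D_E` ⟹ the •-condition, for ANY `M`, ANY set of functionals.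
* §2 `fineSelmerInfty_le_sharpFlatSelmerInfty` — `Sel₀(K_∞, E[p^∞]) ≤ Sel^•(E/K_∞)` at the place `v` (`ι = closureEmb`).
* §3 `SharpFlatSelmerDualData.exists_linearMap_toFineDual` — for a topological generator `γ`, every `D : SharpFlatSelmerDualData … γ …`
  and `Y : W.FineSelmerDualData κ γ` admit a SURJECTIVE `Λ`-linear `k : D.X → Y.X` with `Y.toDual (k x) s = D.toDual x s`;
  `…fineDual_isTorsion` (`X₀` is torsion if `X^•` is), `…fineDual_lengthAt_le` (`ℓ_𝔭 X₀ ≤ ℓ_𝔭 X^•`), `…fineDual_moduleFinite`.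

Nothing about any curve is computed; no named fact is used; BSD / Sprung's Thm. 7.14 / Main Conj. 7.21 are NOT proved by any of this.
References: [Sprung2012] Def. 7.9, Lemma 7.10, Def. 7.11 (p. 1503), Def. 7.13 and Thm. 7.14 (3) (p. 1504), Prop. 7.19 (p. 1505);
[Kobayashi2003] Def. 1.1 (p. 2), (7.17)–(7.21) (p. 12); [CoatesSujatha2005] §3; [GreenbergLNM1716] §1 p. 60, §2; [Greenberg1989] §1 p. 98;
[SerreGaloisCohomology1997] I.§5.1.
-/

set_option autoImplicit false

noncomputable section

open scoped Classical

universe u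

namespace Literature.NumberTheory.EllipticCurves.Sprung2012

open NumberField IsDedekindDomain Field
open Literature.NumberTheory.EllipticCurves Literature.NumberTheory.EllipticCurves.GreenbergSelmer
  Literature.NumberTheory.EllipticCurves.Kobayashi2003 Literature.NumberTheory.EllipticCurves.Module
  Literature.NumberTheory.EllipticCurves.IwasawaDual Literature.NumberTheory.GaloisRepresentations WeierstrassCurve ZpExtension

/-! ## §1 Principal crossed homomorphisms satisfy every •-condition -/

section Principal

variable {K : Type u} [Field K] (W : WeierstrassCurve K) (p : ℕ) [Fact p.Prime]
variable {E : Type u} [Field E] [Algebra K E]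

/-- **Principal on `H ⊓ D_E` ⟹ Sprung's •-condition at `E`, for EVERY subgroup `M` of local points and EVERY set `𝒦` of functionals.**
With `D ⊇ im(Γ_E → Γ_K)` and `φ` on `H` principal on `H ⊓ D` with `t ∈ E[p^∞]`, the class `[φ]` lies in
`sharpFlatLocalKummerOverOfEmb W p H (closureEmb E) M 𝒦` — witnesses: `φ`, the TORSION point `Q = ι t` (`pᵏ Q = 0 ∈ M`), the divisibility
clause `pᵏ ∣ z(pᵏQ) = z(0) = 0`, and `ι φ(τ|) = τ Q − Q` on `H_E` (`pointsMapOfEmb_smul`). The ♯/♭ twin of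
`Kobayashi2003.resOfLe_mem_localKummerOverOfEmb_of_principal` («`0 ∈ E^∗_{∞,𝔭}`»). [cite: Sprung2012, Def. 7.9 and Def. 7.11 (p. 1503)]
[cite: Kobayashi2003, Def. 1.1 and §2 p. 4] -/
theorem mem_sharpFlatLocalKummerOverOfEmb_of_principal {H D : Subgroup (absoluteGaloisGroup K)}
    (hD : ∀ τ : absoluteGaloisGroup E, resGalOfEmb (closureEmb (K := K) E) τ ∈ D)
    (φ : contOneCocycles (discreteTopRep H (W.geomPrimaryTorsion p))) (t : W.geomPrimaryTorsion p)
    (hφ : ∀ (g : absoluteGaloisGroup K) (hg : g ∈ H), g ∈ D → φ.1 ⟨g, hg⟩ = g • t - t)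
    (M : AddSubgroup (localPoints W E)) (𝒦 : Set (M →+ ℤ_[p])) :
    oneCocycleClass _ φ ∈ sharpFlatLocalKummerOverOfEmb W p H (closureEmb (K := K) E) M 𝒦 := by
  obtain ⟨k, hk⟩ := t.2
  have hQ0 : (p ^ k) • pointsMapOfEmb W (closureEmb (K := K) E) (t : W.geomPoints) = 0 := by
    rw [← map_nsmul, hk, map_zero]
  have hQM : (p ^ k) • pointsMapOfEmb W (closureEmb (K := K) E) (t : W.geomPoints) ∈ M := by
    rw [hQ0]; exact zero_mem M
  rw [mem_sharpFlatLocalKummerOverOfEmb_iff]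
  refine ⟨φ, pointsMapOfEmb W (closureEmb (K := K) E) t, k, hQM, rfl, fun z _ ↦ ?_, fun τ ↦ ?_⟩
  · have h0 : (⟨(p ^ k) • pointsMapOfEmb W (closureEmb (K := K) E) (t : W.geomPoints), hQM⟩ : M) = 0 :=
      Subtype.ext hQ0
    rw [h0, map_zero]
    exact dvd_zero _
  · have key : ∀ s : W.geomPrimaryTorsion p, s = resGalOfEmb (closureEmb (K := K) E) τ • t - t →
        pointsMapOfEmb W (closureEmb (K := K) E) (s : W.geomPoints) =
          (τ : absoluteGaloisGroup E) • pointsMapOfEmb W (closureEmb (K := K) E) (t : W.geomPoints) -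
            pointsMapOfEmb W (closureEmb (K := K) E) (t : W.geomPoints) := by
      rintro s rfl
      rw [AddSubgroupClass.coe_sub, primaryComponent.coe_smul, map_sub, pointsMapOfEmb_smul]
    exact key _ (hφ _ τ.2 (hD τ))

end Principal

/-! ## §2 `Sel₀(K_∞, E[p^∞]) ≤ Sel^•(E/K_∞)` -/

section Main

variable {K : Type u} [Field K] [NumberField K] (W : WeierstrassCurve K) {p : ℕ} [Fact p.Prime]
  (κ : ZpExtension K p)

/-- **The fine Selmer group lies in Sprung's chromatic Selmer group**: for every number field `K`, `ℤ_p`-extension `κ`, finite place `v`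
(`ι = closureEmb (v.adicCompletion K)`), data `(ap, g, c)` and colour `•`, `W.fineSelmerInfty κ ≤ sharpFlatSelmerInfty W κ ι ap g c •`.
Sprung's `Sel⁰(E/K_∞) = Ker(Sel → E(K_{∞,𝔭}) ⊗ ℚ_p/ℤ_p)` (Def. 7.13) sits in `Sel^∗ = Ker(Sel → E(K_{∞,𝔭}) ⊗ ℚ_p/ℤ_p / E^∗_{∞,𝔭})` (Def. 7.11)
since `0 ∈ E^∗_{∞,𝔭}`; in the tree: a class of `Sel₀` lies in `Sel` (Kobayashi twin `fineSelmerInfty_le_signedSelmerInfty` with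
`signedSelmerInfty_le_selmerInfty`), and each conjugate `conj_σ c` is locally trivial at `v` (strict datum, or `awayKer` for `v ∤ p`),
hence principal on `Gal(K̄/K_∞) ⊓ D_v`, hence in the •-condition (§1). [cite: Sprung2012, Def. 7.11 (p. 1503) and Def. 7.13 (p. 1504)]
[cite: Kobayashi2003, Def. 1.1 (p. 2)] [cite: CoatesSujatha2005, §3] [cite: Greenberg1989, §1 p. 98] -/
theorem fineSelmerInfty_le_sharpFlatSelmerInfty [W.IsElliptic] (v : HeightOneSpectrum (𝓞 K)) (ap : ℤ)
    (g : absoluteGaloisGroup (v.adicCompletion K)) (c : ℕ → localPoints W (v.adicCompletion K)) (col : Sprung2017.Chroma) :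
    W.fineSelmerInfty κ ≤ sharpFlatSelmerInfty W κ (closureEmb (K := K) (v.adicCompletion K)) ap g c col := by
  intro s hs
  rw [mem_sharpFlatSelmerInfty_iff]
  refine ⟨signedSelmerInfty_le_selmerInfty W κ 1 (fineSelmerInfty_le_signedSelmerInfty W κ 1 hs), fun σ ↦ ?_⟩
  have hs' := (mem_strictSelmerGroupOver_iff (H := κ.kerSubgroup) (M := W.geomPrimaryTorsion p)
    (L := fineData (W.geomPrimaryTorsion p) p) s).1 hs
  -- `conj_σ s` is locally trivial at `v`
  have h0 : resOfLe (W.geomPrimaryTorsion p)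
      (inf_le_left : κ.kerSubgroup ⊓ decomp (K := K) v ≤ κ.kerSubgroup) (W.conjH1 p κ.kerSubgroup σ s) = 0 := by
    by_cases hv : ((p : ℕ) : 𝓞 K) ∈ v.asIdeal
    · exact resOfLe_inf_decomp_eq_zero_of_mem_strictKer_fineLocalDatum W p v (hs'.2.2 v hv σ)
    · exact hs'.1 v hv σ
  -- hence principal on `ker κ ⊓ D_v`, hence in the •-condition
  obtain ⟨φ, hφ⟩ := oneCocycleClass_surjective _ (W.conjH1 p κ.kerSubgroup σ s)
  rw [← hφ] at h0 ⊢
  obtain ⟨t, ht⟩ := exists_principal_of_resOfLe_eq_zero W p inf_le_left φ h0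
  exact mem_sharpFlatLocalKummerOverOfEmb_of_principal W p (resGalOfEmb_mem_decomp v) φ t
    (fun g' hg' hgD ↦ ht g' hg' (Subgroup.mem_inf.2 ⟨hg', hgD⟩)) _ _

/-- The inclusion `Sel₀(K_∞, E[p^∞]) ↪ Sel^•(E/K_∞)` intertwines `conj_γ − 1` (both are restrictions of `conj_γ − 1` on `H¹(K_∞, E[p^∞])`);
the ♯/♭ twin of `Kobayashi2003.inclusion_conjFineSelmerInfty_sub_one`. [cite: Sprung2012, Def. 7.11 (p. 1503)] -/
theorem inclusion_conjFineSelmerInfty_sub_one_sharpFlat [W.IsElliptic] (v : HeightOneSpectrum (𝓞 K)) (ap : ℤ)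
    (g : absoluteGaloisGroup (v.adicCompletion K)) (c : ℕ → localPoints W (v.adicCompletion K)) (col : Sprung2017.Chroma)
    (γ : absoluteGaloisGroup K) (s : W.fineSelmerInfty κ) :
    AddSubgroup.inclusion (fineSelmerInfty_le_sharpFlatSelmerInfty W κ v ap g c col) ((W.conjFineSelmerInfty κ γ - 1) s) =
      (conjSharpFlatSelmerInfty W κ (closureEmb (K := K) (v.adicCompletion K)) ap g c col γ - 1)
        (AddSubgroup.inclusion (fineSelmerInfty_le_sharpFlatSelmerInfty W κ v ap g c col) s) := by
  apply Subtype.ext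
  rw [AddSubgroup.coe_inclusion, WeierstrassCurve.coe_conjFineSelmerInfty_sub_one_apply, IwasawaDual.End_sub_apply,
    AddMonoid.End.one_apply, AddSubgroupClass.coe_sub, coe_conjSharpFlatSelmerInfty_apply, AddSubgroup.coe_inclusion]

end Main

/-! ## §3 The Pontryagin transpose: `X^•(E/K_∞) ↠ X₀(E/K_∞)`, `Λ`-linearly -/

namespace SharpFlatSelmerDualData

variable {K : Type u} [Field K] [NumberField K] {W : WeierstrassCurve K} {p : ℕ} [Fact p.Prime]
  {κ : ZpExtension K p} {γ : absoluteGaloisGroup K} {v : HeightOneSpectrum (𝓞 K)} {ap : ℤ}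
  {g : absoluteGaloisGroup (v.adicCompletion K)} {c : ℕ → localPoints W (v.adicCompletion K)} {col : Sprung2017.Chroma}

/-- **`X^•(E/K_∞) ↠ X₀(E/K_∞)`, `Λ`-linearly** — the arrow `X^∗(E/K_∞) → X⁰(E/K_∞) → 0` of Sprung's (3) / Prop. 7.19 on the tree's
pinned dual data. For `γ` a topological generator, `D : SharpFlatSelmerDualData W κ γ (closureEmb (v.adicCompletion K)) ap g c •` and
`Y : W.FineSelmerDualData κ γ` there is a SURJECTIVE `Λ`-linear `k : D.X → Y.X` transposing `Sel₀ ≤ Sel^•`: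
`Y.toDual (k x) s = D.toDual x s` for `s ∈ Sel₀`. Generic functoriality of dual pairs (`IsDualPair.exists_linearMap_comp_surjective`,
`ℚ/ℤ` divisible) on `D.isDualPair`, `Y.isDualPair`. [cite: Sprung2012, Thm. 7.14 with (3) (p. 1504) and Prop. 7.19 (p. 1505)]
[cite: Kobayashi2003, (7.17)–(7.21) (p. 12)] -/
theorem exists_linearMap_toFineDual [W.IsElliptic] (hγ : κ.IsTopGenerator γ)
    (D : SharpFlatSelmerDualData W κ γ (closureEmb (K := K) (v.adicCompletion K)) ap g c col) (Y : W.FineSelmerDualData κ γ) :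
    ∃ k : D.X →ₗ[IwasawaAlgebra p] Y.X, Function.Surjective k ∧
      ∀ (x : D.X) (s : W.fineSelmerInfty κ),
        Y.toDual (k x) s = D.toDual x (AddSubgroup.inclusion (fineSelmerInfty_le_sharpFlatSelmerInfty W κ v ap g c col) s) :=
  (D.isDualPair hγ).exists_linearMap_comp_surjective (Y.isDualPair hγ)
    (AddSubgroup.inclusion (fineSelmerInfty_le_sharpFlatSelmerInfty W κ v ap g c col))
    (fun s ↦ inclusion_conjFineSelmerInfty_sub_one_sharpFlat W κ v ap g c col γ s) (AddSubgroup.inclusion_injective _)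

/-- **`X₀(E/K_∞)` is `Λ`-torsion when `X^•(E/K_∞)` is** (a quotient of a torsion module) — e.g. from Sprung's Thm. 7.14 for a colour with
`L^•_p ≠ 0`. [cite: Sprung2012, Thm. 7.14 (p. 1504)] [cite: Kobayashi2003, Cor. 7.2 and (7.21) (pp. 12–13)] -/
theorem fineDual_isTorsion [W.IsElliptic] (hγ : κ.IsTopGenerator γ)
    (D : SharpFlatSelmerDualData W κ γ (closureEmb (K := K) (v.adicCompletion K)) ap g c col) (Y : W.FineSelmerDualData κ γ)
    (hX : Module.IsTorsion (IwasawaAlgebra p) D.X) : Module.IsTorsion (IwasawaAlgebra p) Y.X := by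
  obtain ⟨k, hk, -⟩ := D.exists_linearMap_toFineDual hγ Y
  intro y
  obtain ⟨x, rfl⟩ := hk y
  obtain ⟨a, ha⟩ := @hX x
  exact ⟨a, by rw [Submonoid.smul_def, ← map_smul, ← Submonoid.smul_def, ha, map_zero]⟩

/-- **`ℓ_𝔭(X₀) ≤ ℓ_𝔭(X^•)` at every prime `𝔭` of `Λ`** (a quotient has smaller local length). [cite: Sprung2012, Thm. 7.14 (3) (p. 1504)] -/
theorem fineDual_lengthAt_le [W.IsElliptic] (hγ : κ.IsTopGenerator γ)
    (D : SharpFlatSelmerDualData W κ γ (closureEmb (K := K) (v.adicCompletion K)) ap g c col) (Y : W.FineSelmerDualData κ γ)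
    (𝔭 : PrimeSpectrum (IwasawaAlgebra p)) :
    lengthAt (IwasawaAlgebra p) Y.X 𝔭 ≤ lengthAt (IwasawaAlgebra p) D.X 𝔭 := by
  obtain ⟨k, hk, -⟩ := D.exists_linearMap_toFineDual hγ Y
  exact lengthAt_le_of_surjective k hk 𝔭

/-- **`X₀(E/K_∞)` is finitely generated over `Λ`** whenever a chromatic dual datum keyed by a topological generator is at hand (a quotient of
the finitely generated `X^•`, `SharpFlatSelmerDualData.moduleFinite`). [cite: Sprung2012, Thm. 1.2 (p. 1486) and Thm. 7.14 (3) (p. 1504)] -/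
theorem fineDual_moduleFinite [W.IsElliptic] (hγ : κ.IsTopGenerator γ)
    (D : SharpFlatSelmerDualData W κ γ (closureEmb (K := K) (v.adicCompletion K)) ap g c col) (Y : W.FineSelmerDualData κ γ) :
    Module.Finite (IwasawaAlgebra p) Y.X := by
  haveI : Module.Finite (IwasawaAlgebra p) D.X := D.moduleFinite hγ
  obtain ⟨k, hk, -⟩ := D.exists_linearMap_toFineDual hγ Y
  exact Module.Finite.of_surjective k hk

end SharpFlatSelmerDualData

end Literature.NumberTheory.EllipticCurves.Sprung2012

end
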